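import Literature.Analysis.FluidPDE.FluidComputer.ThresholdLevelTableURun0
import Literature.Analysis.FluidPDE.FluidComputer.ThresholdLevelTableURun1
import Literature.Analysis.FluidPDE.FluidComputer.ThresholdLevelTableURun2
import Literature.Analysis.FluidPDE.FluidComputer.ThresholdLevelTableURun3
import Literature.Analysis.FluidPDE.FluidComputer.ThresholdLevelTableURun4
import Literature.Analysis.FluidPDE.FluidComputer.ThresholdLevelTableURun5
import Literature.Analysis.FluidPDE.FluidComputer.ThresholdLevelTableURun6
import Literature.Analysis.FluidPDE.FluidComputer.ThresholdLevelTableURun7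
import Literature.Analysis.FluidPDE.FluidComputer.ThresholdLevelTableURun8
import Literature.Analysis.FluidPDE.FluidComputer.ThresholdLevelTableURun9
import Literature.Analysis.FluidPDE.FluidComputer.ThresholdLevelTableURun10
import Literature.Analysis.FluidPDE.FluidComputer.ThresholdLevelTableURun11
import Literature.Analysis.FluidPDE.FluidComputer.ThresholdLevelTableURun12
import Literature.Analysis.FluidPDE.FluidComputer.ThresholdLevelTableURun13
import Literature.Analysis.FluidPDE.FluidComputer.ThresholdLevelTableURun14
import Literature.Analysis.FluidPDE.FluidComputer.ThresholdLevelTableURun15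
import Literature.Analysis.FluidPDE.FluidComputer.ThresholdLevelCertificate
import HarnessLib

/-!
# Certificate: the transfer stage UNIFORMLY on the 10⁻² box in ALL SEVEN gate data, by a re-cut table (bp3 gen 13, layer 4: robustness variant U)

HONEST FRAMING: low prior, high value-of-information experiment on Tao's machine paradigm; NOT a
claim that NS blows up.

For EVERY gate datum `G = (ε, σ, ν, μ, r, κ, δ)` in the box `GIu` — each of the six couplings within
relative `10⁻²` of the A = 2 design values `ε₀ = 0.2`, `σ₀ ≈ 3.58·10⁻⁴`, `ν₀ = 480`, `μ₀ = 96`,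
`r₀ ≈ 1.1757·10⁴`, `κ₀ = 4800`, and any forcing defect `0 ≤ δ ≤ 1.01·δ₀`, `δ₀ ≈ 3.58·10⁻⁶` — every
`δ`-approximate orbit of `thresholdCircuit ε σ ν μ r κ` started in the design-point level-`0` entry box
(`ThresholdLevelTable.Bc0`: carrier `a ∈ [0.96980, 0.97039]`, clock `b ∈ [0.23043, 0.23057]`, trigger
`c = C₀ ≈ 4.08·10⁻⁴`, slaving residual `∈ [−0.1068, −0.0985]`, output `z ∈ [0.074850, 0.074895]`, energy
`∈ [0.99940, 1.00060]`; nonempty by `ThresholdLevelTable.pEntry_mem`), continuous on `[0, T₃ᵘ]`,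
`T₃ᵘ = T₃U = 268315845877002378/2^60 ≈ 0.23273`, satisfies `x s 4 ^ 2 ≥ EoutU = (1086864359146170707/2^60)² ≈ 0.88869`
at some `s ∈ [0, T₃ᵘ]` (`dataBoxU_transfer_reach`): at least `88.82 %` of the entry energy in the output
mode, uniformly on a data box TEN times as wide as `ThresholdLevelCertificateW`'s (`10⁻³`, `92.25 %`) and
three times `ThresholdLevelCertificateX`'s (`1/300`, `91.68 %`).  Unlike W and X, the TABLE IS RE-CUT
(`ThresholdLevelTableU.lean`: halved levels, last two design levels dropped) — the first instance of re-tuning the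
table to the box rather than spending the design-point margin; the price is the lower certified load
(`88.8 %` instead of `92.5 %`: the run stops at design level 798 and the wide box smears the final `z`).
Proof as for W: `runU0 … runU63` (`ThresholdLevelTableURun0 … 15`), `runSteps_append_some`, `TableD.rowsValid_of_runSteps`,
`ThresholdLevelTable.sum_range_getD_h`, `levelTableStage_reach`.  Every name carries the tag `U`.
Sorry-free; standard axioms only.

WHAT THIS IS NOT: stage 3 only, of one gate of the `5`-mode truncated circuit with an abstract forcing
defect; a constant robustness margin on a small box; not the gate verdict, not a statement about the
averaged or true equations, not evidence for blow-up.
-/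

noncomputable section

open Set

namespace Literature.Analysis.FluidPDE.FluidComputer

open Literature.Analysis.FluidPDE.Tao2016AveragedNS

namespace ThresholdLevelTableU

open ThresholdLevelTable (Bc0 RbIt Rbt RbIt_mem Gt Lt)

/-- The whole re-cut table run over the 10⁻² box: all 1596 steps pass and generate `Bu64`. [folklore] -/
theorem runU_all : runSteps 60 12 3 GIu RbIt Bc0 stepsU CNu = some Bu64 :=
  runSteps_append_some 60 12 3 GIu RbIt runU0
    (runSteps_append_some 60 12 3 GIu RbIt runU1
    (runSteps_append_some 60 12 3 GIu RbIt runU2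
    (runSteps_append_some 60 12 3 GIu RbIt runU3
    (runSteps_append_some 60 12 3 GIu RbIt runU4
    (runSteps_append_some 60 12 3 GIu RbIt runU5
    (runSteps_append_some 60 12 3 GIu RbIt runU6
    (runSteps_append_some 60 12 3 GIu RbIt runU7
    (runSteps_append_some 60 12 3 GIu RbIt runU8
    (runSteps_append_some 60 12 3 GIu RbIt runU9
    (runSteps_append_some 60 12 3 GIu RbIt runU10
    (runSteps_append_some 60 12 3 GIu RbIt runU11
    (runSteps_append_some 60 12 3 GIu RbIt runU12
    (runSteps_append_some 60 12 3 GIu RbIt runU13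
    (runSteps_append_some 60 12 3 GIu RbIt runU14
    (runSteps_append_some 60 12 3 GIu RbIt runU15
    (runSteps_append_some 60 12 3 GIu RbIt runU16
    (runSteps_append_some 60 12 3 GIu RbIt runU17
    (runSteps_append_some 60 12 3 GIu RbIt runU18
    (runSteps_append_some 60 12 3 GIu RbIt runU19
    (runSteps_append_some 60 12 3 GIu RbIt runU20
    (runSteps_append_some 60 12 3 GIu RbIt runU21
    (runSteps_append_some 60 12 3 GIu RbIt runU22
    (runSteps_append_some 60 12 3 GIu RbIt runU23
    (runSteps_append_some 60 12 3 GIu RbIt runU24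
    (runSteps_append_some 60 12 3 GIu RbIt runU25
    (runSteps_append_some 60 12 3 GIu RbIt runU26
    (runSteps_append_some 60 12 3 GIu RbIt runU27
    (runSteps_append_some 60 12 3 GIu RbIt runU28
    (runSteps_append_some 60 12 3 GIu RbIt runU29
    (runSteps_append_some 60 12 3 GIu RbIt runU30
    (runSteps_append_some 60 12 3 GIu RbIt runU31
    (runSteps_append_some 60 12 3 GIu RbIt runU32
    (runSteps_append_some 60 12 3 GIu RbIt runU33
    (runSteps_append_some 60 12 3 GIu RbIt runU34
    (runSteps_append_some 60 12 3 GIu RbIt runU35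
    (runSteps_append_some 60 12 3 GIu RbIt runU36
    (runSteps_append_some 60 12 3 GIu RbIt runU37
    (runSteps_append_some 60 12 3 GIu RbIt runU38
    (runSteps_append_some 60 12 3 GIu RbIt runU39
    (runSteps_append_some 60 12 3 GIu RbIt runU40
    (runSteps_append_some 60 12 3 GIu RbIt runU41
    (runSteps_append_some 60 12 3 GIu RbIt runU42
    (runSteps_append_some 60 12 3 GIu RbIt runU43
    (runSteps_append_some 60 12 3 GIu RbIt runU44
    (runSteps_append_some 60 12 3 GIu RbIt runU45
    (runSteps_append_some 60 12 3 GIu RbIt runU46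
    (runSteps_append_some 60 12 3 GIu RbIt runU47
    (runSteps_append_some 60 12 3 GIu RbIt runU48
    (runSteps_append_some 60 12 3 GIu RbIt runU49
    (runSteps_append_some 60 12 3 GIu RbIt runU50
    (runSteps_append_some 60 12 3 GIu RbIt runU51
    (runSteps_append_some 60 12 3 GIu RbIt runU52
    (runSteps_append_some 60 12 3 GIu RbIt runU53
    (runSteps_append_some 60 12 3 GIu RbIt runU54
    (runSteps_append_some 60 12 3 GIu RbIt runU55
    (runSteps_append_some 60 12 3 GIu RbIt runU56
    (runSteps_append_some 60 12 3 GIu RbIt runU57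
    (runSteps_append_some 60 12 3 GIu RbIt runU58
    (runSteps_append_some 60 12 3 GIu RbIt runU59
    (runSteps_append_some 60 12 3 GIu RbIt runU60
    (runSteps_append_some 60 12 3 GIu RbIt runU61
    (runSteps_append_some 60 12 3 GIu RbIt runU62
    (runU63)))))))))))))))))))))))))))))))))))))))))))))))))))))))))))))))

/-- The certified output load on the 10⁻² box, `(zℓ after step 1596)² ≈ 0.88869`. [folklore] -/
def EoutU : ℝ := ((1086864359146170707 : ℝ) / 2 ^ 60) ^ 2

/-- The stage time budget of the re-cut table, `T₃ᵘ = Σ h ≈ 0.23273`. [folklore] -/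
def T₃U : ℝ := (268315845877002378 : ℝ) / 2 ^ 60

/-- Gate data in the 10⁻² box are admissible (signs). [folklore] -/
theorem valid_of_memU {G : GateData} (hG : GIu.Mem 60 G) : G.Valid :=
  ⟨DI.nonneg_of_nonnegB (I := GIu.ε) (by decide) hG.ε,
    DI.nonneg_of_nonnegB (I := GIu.σ) (by decide) hG.σ,
    DI.nonneg_of_nonnegB (I := GIu.ν) (by decide) hG.ν,
    DI.nonneg_of_nonnegB (I := GIu.μ) (by decide) hG.μ,
    DI.nonneg_of_nonnegB (I := GIu.r) (by decide) hG.r,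
    DI.pos_of_posB (I := GIu.κ) (by decide) hG.κ,
    DI.nonneg_of_nonnegB (I := GIu.δ) (by decide) hG.δ⟩

/-- The sum of the re-cut caps, checked by the kernel. [folklore] -/
theorem hsumU_eq : (stepsU.map StepD.h).sum = HsumU := by
  decide +kernel

/-- The real level table generated for the 10⁻² box. [folklore] -/
def LtU : LevelTable := tableU.toTable 60 12 3 GIu RbIt

/-- Its rows are valid for every gate datum in the box, and the final entry box is `Bu64`. [folklore] -/
theorem LtU_rowsValid {G : GateData} (hG : GIu.Mem 60 G) :
    LtU.RowsValid G Rbt ∧ tableU.entry 60 12 3 GIu RbIt tableU.steps.length = Bu64 :=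
  TableD.rowsValid_of_runSteps (by norm_num) hG RbIt_mem tableU runU_all

/-- The caps of `LtU` sum to `T₃U`. [folklore] -/
theorem LtU_time : ∑ k ∈ Finset.range LtU.N, LtU.h k = T₃U := by
  show ∑ k ∈ Finset.range stepsU.length, (((stepsU.getD k ⟨CNu, 0⟩).h : ℝ) / 2 ^ 60) = T₃U
  rw [ThresholdLevelTable.sum_range_getD_h, hsumU_eq]
  norm_num [T₃U, HsumU]

/-- The level-`0` entry box and level are those of the design-point table. [folklore] -/
theorem LtU_B_zero : LtU.B 0 = Lt.B 0 ∧ LtU.C 0 = Lt.C 0 := ⟨rfl, rfl⟩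

/-- Energy confinement margin, uniformly in `δ ≤ 1.01 δ₀`, for the longer budget `T₃U`. [folklore] -/
theorem LtU_energy {G : GateData} (hG : GIu.Mem 60 G) :
    ∀ q ∈ {q | (LtU.B 0).mem G.κ G.r (LtU.C 0) q}, energy q + 10 * (G.δ * Rbt) * T₃U < Rbt ^ 2 := by
  intro q hq
  have hEh : energy q ≤ ((1153613361157173206 : ℤ) : ℝ) / 2 ^ 60 := hq.2.2.2.2.2.2
  have hδ : G.δ * 2 ^ 60 ≤ ((4166071436150 : ℤ) : ℝ) := hG.δ.2
  have hnum : ((1153613361157173206 : ℤ) : ℝ) / 2 ^ 60 +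
      10 * ((((4166071436150 : ℤ) : ℝ) / 2 ^ 60) * Rbt) * T₃U < Rbt ^ 2 := by
    norm_num [Rbt, T₃U]
  have hRb : (0 : ℝ) < Rbt := by norm_num [Rbt]
  have hT : (0 : ℝ) < T₃U := by norm_num [T₃U]
  have hδ' : G.δ ≤ ((4166071436150 : ℤ) : ℝ) / 2 ^ 60 := by
    rw [le_div_iff₀ (by positivity)]; exact hδ
  have hmono : 10 * (G.δ * Rbt) * T₃U ≤ 10 * ((((4166071436150 : ℤ) : ℝ) / 2 ^ 60) * Rbt) * T₃U := by
    have := mul_le_mul_of_nonneg_right hδ' hRb.le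
    nlinarith
  linarith

/-- The final entry box certifies the output load. [folklore] -/
theorem LtU_exit {G : GateData} (hG : GIu.Mem 60 G) :
    ∀ X, (LtU.B LtU.N).mem G.κ G.r (LtU.C LtU.N) X → EoutU ≤ X 4 ^ 2 := by
  intro X hX
  have hB : LtU.B LtU.N = Bu64.toReal 60 := by
    show (tableU.entry 60 12 3 GIu RbIt tableU.steps.length).toReal 60 = _
    rw [(LtU_rowsValid hG).2]
  rw [hB] at hX
  have hz : ((1086864359146170707 : ℤ) : ℝ) / 2 ^ 60 ≤ X 4 := hX.2.2.2.2.1.1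
  have h0 : (0 : ℝ) ≤ ((1086864359146170707 : ℤ) : ℝ) / 2 ^ 60 := by positivity
  calc EoutU = (((1086864359146170707 : ℤ) : ℝ) / 2 ^ 60) ^ 2 := by norm_num [EoutU]
    _ ≤ X 4 ^ 2 := pow_le_pow_left₀ h0 hz 2

/-- The stage-3 reach certificate for every gate datum in the 10⁻² box. [folklore] -/
def dataBoxU_transferStage {G : GateData} (hG : GIu.Mem 60 G) :
    ReachCertificate (thresholdCircuit G.ε G.σ G.ν G.μ G.r G.κ) (modeBall Rbt) G.δ T₃U
      {q | (LtU.B 0).mem G.κ G.r (LtU.C 0) q} (outputLoaded EoutU) :=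
  levelTableStage G (valid_of_memU hG) Rbt T₃U EoutU LtU _ (by norm_num [Rbt]) (LtU_rowsValid hG).1
    LtU_time.le (LtU_energy hG) (fun _ hq => hq) (LtU_exit hG)

/-- THE 10⁻² UNIFORM CERTIFICATE.  For every gate datum `G` in the box `GIu` (all six couplings within
relative `10⁻²` of the design point, `0 ≤ δ ≤ 1.01 δ₀`), every `G.δ`-approximate orbit of the threshold
circuit started in the level-`0` entry box loads the output mode to `x s 4 ^ 2 ≥ EoutU ≈ 0.88869` at
some time `s ≤ T₃U ≈ 0.23273`.  [cite: Tao2016AveragedNS, §5.5 Thm 5.3 (5.5)] -/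
theorem dataBoxU_transfer_reach {G : GateData} (hG : GIu.Mem 60 G) {p : Fin 5 → ℝ}
    (hp : (LtU.B 0).mem G.κ G.r (LtU.C 0) p) {x : ℝ → Fin 5 → ℝ} (hx0 : x 0 = p)
    (hcont : ContinuousOn x (Icc 0 T₃U))
    (hder : ∀ s ∈ Ico 0 T₃U, ∃ W : Fin 5 → ℝ, HasDerivWithinAt x W (Ici s) s ∧
      ‖W - thresholdCircuit G.ε G.σ G.ν G.μ G.r G.κ (x s)‖ ≤ G.δ) :
    ∃ s ∈ Icc 0 T₃U, EoutU ≤ x s 4 ^ 2 :=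
  levelTableStage_reach G (valid_of_memU hG) Rbt T₃U EoutU LtU
    {q | (LtU.B 0).mem G.κ G.r (LtU.C 0) q} (by norm_num [Rbt]) (LtU_rowsValid hG).1 LtU_time.le
    (by norm_num [T₃U]) (LtU_energy hG) (fun _ hq => hq) (LtU_exit hG) hp hx0 hcont hder

/-- The design point itself lies in the 10⁻² box. [folklore] -/
theorem Gt_memU : GIu.Mem 60 Gt :=
  ⟨by norm_num [DI.mem, GIu, Gt], by norm_num [DI.mem, GIu, Gt], by norm_num [DI.mem, GIu, Gt],
    by norm_num [DI.mem, GIu, Gt], by norm_num [DI.mem, GIu, Gt], by norm_num [DI.mem, GIu, Gt],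
    by norm_num [DI.mem, GIu, Gt]⟩

end ThresholdLevelTableU

end Literature.Analysis.FluidPDE.FluidComputer

end
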